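import Literature.NumberTheory.Automorphic.SplitOrthogonalSatakeStarInvariants
import Literature.NumberTheory.Automorphic.SplitOrthogonalSatakeIsomorphism
import HarnessLib

/-!
# The three descriptions of the image of the Satake transform of `U(σ, J₀)` / `O_N(J₀)` agree: the monomial twist
# `x^μ ↦ u^{-e(μ)} x^μ` carries the twisted invariants `𝒯_R` of the COUNTING transform onto the honest Weyl invariants
# `R[Λ⁻]^W` of the NORMALISED transform (Cartier §IV (4.2); Treumann–Venkatesh §7.2 `𝒮^* = δ^{-1/2}𝒮`)

Topic `NumberTheory/Automorphic`; namespace `Literature.NumberTheory.Automorphic.HermitianLattice[.UnramifiedLocalConjDatum]`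
(lane `lit-hodgefound`, Track 2 foundations; seat `lit-hodgefound-p11`, generation 49, row g49-#12).  THEOREMS ONLY: no definition,
no named fact, no instance, no notation.  A coherence file for the generation-49 image theorems: g49-#1
(`HyperspecialUnitarySatakeIsomorphismIntegral`: `𝒮_w(ℋ(U_N)) = R[Λ⁻]^W = unitarySatakeTarget R N`, `w = u^{-⟨ν,·⟩}`, `u = q_F ∈ Rˣ`),
g49-#3 (`SplitOrthogonalSatakeIsomorphism`: the same for `O_N(J₀)`, `w = u^{-Λ}`, `u² = q`), g49-#6
(`HyperspecialUnitarySatakeCountingImage`: `𝒮_1(ℋ(U_N)) = 𝒯_R(q_F) = twistedSatakeTarget`, EVERY `R`), g49-#9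
(`SplitOrthogonalSatakeCountingImage`: `𝒮_1(ℋ(O_N)) = 𝒯^{O}_R(q)`), g49-#11 (`SplitOrthogonalSatakeStarInvariants`: `= R[Λ]^{(W,*)}` for a
unit `q`).

## The mathematics and the print

[CartierCorvallis1979] §IV (4.2)–(4.3): the Satake transform with the factor `δ^{1/2}` and without it differ by the character
`δ^{1/2}` of the torus, i.e. by the monomial twist `x^μ ↦ δ^{1/2}(ϖ^μ) x^μ` of `ℂ[X_*(A)]`; [TreumannVenkatesh2016] §7.2:
«`𝒮^* := δ^{-1/2} 𝒮` […] `𝒮^*` is an isomorphism onto the `(W_{0,v}, *)`-invariant subring».  In the tree every normalisation is a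
twist of the counting transform: `𝒮_w = monomialTwist w ∘ 𝒮_1` (`IsIwasawaExponent.satakeTransform_eq_monomialTwist_comp`).
HERE, purely combinatorially (no group, no `hd`): for a unit `u ∈ Rˣ` with `u = b` in `R` and the weight `w = u^{-⟨ν,·⟩}`,
**`monomialTwist w f ∈ R[Λ⁻]^W ⟺ f ∈ 𝒯_R(b)`** and `monomialTwist w (𝒯_R(b)) = R[Λ⁻]^W` (the unitary case); for `u² = q` and
`w = u^{-Λ}`, `Λ = ⟨ν,·⟩ - hs`, **`monomialTwist w f ∈ R[Λ⁻]^W ⟺ f ∈ R[Λ]^{(W,*)}(u²) ⟺ f ∈ 𝒯^{O}_R(q)`** (the orthogonal case;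
the parity theorem of g49-#10 converts `u^{Λ(μ∘π)-Λ(μ)}` into `(u²)^{(Λ(μ∘π)-Λ(μ))/2}`).  With `hd` these give back the commutative
squares `satakeAlgEquivOfUnits = monomialTwist w ∘ countingSatakeLinearEquiv` and its orthogonal twin.

## What is formalised (theorems only)

* §1 (`U_N`) **`monomialTwist_mem_unitarySatakeTarget_iff_mem_twistedSatakeTarget`**, `map_monomialTwist_twistedSatakeTarget_eq`.
* §2 (`O_N`) **`monomialTwist_mem_unitarySatakeTarget_iff_mem_orthogonalStarInvariants`**,
  `monomialTwist_mem_unitarySatakeTarget_iff_mem_orthogonalTwistedSatakeTarget`, `map_monomialTwist_orthogonalTwistedSatakeTarget_eq`.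
* §3 (with `hd`) `coe_satakeAlgEquivOfUnits_eq_monomialTwist_countingSatakeLinearEquiv`,
  `coe_satakeAlgEquivOrthogonal_eq_monomialTwist_countingSatakeLinearEquivOrthogonal`.

## References
* [CartierCorvallis1979] P. Cartier, *Representations of 𝔭-adic groups: a survey*, PSPM 33.1 (1979), §IV (4.2)–(4.3), Thm. 4.1.
* [TreumannVenkatesh2016] D. Treumann, A. Venkatesh, *Functoriality, Smith theory, and the Brauer homomorphism*, Ann. of Math. 183
  (2016), §7.2.
* [GrossSatake1998] B. H. Gross, *On the Satake isomorphism* (1998), §3 (3.3)–(3.4), Prop. 3.6.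
-/

noncomputable section

open scoped Valued WithZero Matrix MatrixGroups
open MonoidAlgebra Representation

namespace Literature.NumberTheory.Automorphic.HermitianLattice

open Literature.NumberTheory.Automorphic Literature.NumberTheory.Automorphic.CartanUnique
  Literature.NumberTheory.Automorphic.SymplecticCartan

variable {R : Type*} [CommRing R] {N : ℕ}

/-! ## §0 Plumbing -/

section Plumbing

omit [CommRing R] in
/-- Undoing a coordinate permutation: `(μ ∘ π) ∘ π⁻¹ = μ` (private plumbing). [folklore] -/
private theorem comp_perm_comp_inv₃ (μ : Fin N → ℤ) (π : Equiv.Perm (Fin N)) : (μ ∘ ⇑π) ∘ ⇑π⁻¹ = μ := by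
  rw [Function.comp_assoc, ← Equiv.Perm.coe_mul, mul_inv_cancel, Equiv.Perm.coe_one, Function.comp_id]

/-- `u^e = b^{e.toNat}` in `R` for a unit `u = b` and `e ≥ 0` (private plumbing). [folklore] -/
private theorem units_zpow_eq_pow_toNat₃ (u : Rˣ) {b : ℕ} (hu : (u : R) = b) {e : ℤ} (he : 0 ≤ e) :
    ((u ^ e : Rˣ) : R) = (b : R) ^ e.toNat := by
  obtain ⟨n, rfl⟩ := Int.eq_ofNat_of_zero_le he
  rw [zpow_natCast, Units.val_pow_eq_pow_val, hu, Int.toNat_natCast]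

/-- Moving a unit power across an equation: `↑(u^{-a}) x = ↑(u^{-c}) y ⟺ x = ↑(u^{a-c}) y` (private plumbing). [folklore] -/
private theorem units_zpow_neg_mul_eq_iff (u : Rˣ) (a c : ℤ) (x y : R) :
    ((u ^ (-a) : Rˣ) : R) * x = ((u ^ (-c) : Rˣ) : R) * y ↔ x = ((u ^ (a - c) : Rˣ) : R) * y := by
  constructor
  · intro h
    have h1 := congrArg (fun z => ((u ^ a : Rˣ) : R) * z) h
    rwa [← mul_assoc, ← Units.val_mul, ← zpow_add, add_neg_cancel, zpow_zero, Units.val_one, one_mul, ← mul_assoc,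
      ← Units.val_mul, ← zpow_add, ← sub_eq_add_neg] at h1
  · intro h
    rw [h, ← mul_assoc, ← Units.val_mul, ← zpow_add, show -a + (a - c) = -c by ring]

end Plumbing

/-! ## §1 `U(σ, J₀)`: `monomialTwist (u^{-⟨ν,·⟩}) (𝒯_R(b)) = R[Λ⁻]^W` for a unit `u = b` -/

section Unitary

/-- **`monomialTwist w f ∈ R[Λ⁻]^W ⟺ f ∈ 𝒯_R(b)`** for a unit `u` with `u = b` in `R` and the weight `w = u^{-⟨ν,·⟩}`: the
honest `W`-invariance of the normalised element `u^{-⟨ν,μ⟩} f_μ` is the twisted relation `f_{μ∘π} = b^{⟨ν,μ∘π⟩-⟨ν,μ⟩} f_μ` of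
g49-#6 (one-sided, the other side recovered from the relation at `(μ∘π, π⁻¹)` by inverting the unit).
[cite: CartierCorvallis1979, §IV (4.2)–(4.3)] [cite: TreumannVenkatesh2016, §7.2] -/
theorem monomialTwist_mem_unitarySatakeTarget_iff_mem_twistedSatakeTarget (u : Rˣ) {b : ℕ} (hu : (u : R) = b)
    (w : Multiplicative (Fin N → ℤ) →* R) (hw : ∀ e : Fin N → ℤ, w (Multiplicative.ofAdd e) = ((u ^ (-satakeTwistExp e) : Rˣ) : R))
    (f : AddMonoidAlgebra R (Fin N → ℤ)) :
    monomialTwist w f ∈ unitarySatakeTarget R N ↔ f ∈ twistedSatakeTarget R N b := by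
  rw [mem_unitarySatakeTarget_iff, mem_twistedSatakeTarget_iff]
  simp only [coeff_monomialTwist, hw]
  refine and_congr ⟨fun h μ hμ => ?_, fun h μ hμ => ?_⟩ ⟨fun h π hπ μ hle => ?_, fun h π hπ μ => ?_⟩
  · exact (Units.isUnit _).mul_right_eq_zero.1 (h μ hμ)
  · rw [h μ hμ, mul_zero]
  · rw [(units_zpow_neg_mul_eq_iff u _ _ _ _).1 (h π hπ μ), units_zpow_eq_pow_toNat₃ u hu (sub_nonneg.2 hle)]
  · rw [units_zpow_neg_mul_eq_iff]
    rcases le_or_gt (satakeTwistExp μ) (satakeTwistExp (μ ∘ π)) with hle | hlt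
    · rw [h π hπ μ hle, units_zpow_eq_pow_toNat₃ u hu (sub_nonneg.2 hle)]
    · have hrel := h π⁻¹ (perm_inv_rev hπ) (μ ∘ π) (by rw [comp_perm_comp_inv₃]; exact hlt.le)
      rw [comp_perm_comp_inv₃] at hrel
      rw [hrel, ← units_zpow_eq_pow_toNat₃ u hu (show (0 : ℤ) ≤ _ by omega), ← mul_assoc, ← Units.val_mul, ← zpow_add,
        show satakeTwistExp (μ ∘ ⇑π) - satakeTwistExp μ + (satakeTwistExp μ - satakeTwistExp (μ ∘ ⇑π)) = 0 by ring, zpow_zero,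
        Units.val_one, one_mul]

/-- **`monomialTwist (u^{-⟨ν,·⟩})` maps `𝒯_R(b)` ONTO `R[Λ⁻]^W`** (`u = b` a unit): the two images of `ℋ(U(σ,J₀), K₀; R)` — under the
counting transform (g49-#6) and under the normalised transform (g49-#1) — correspond under the change of normalisation.
[cite: CartierCorvallis1979, §IV (4.2)–(4.3)] [cite: TreumannVenkatesh2016, §7.2] -/
theorem map_monomialTwist_twistedSatakeTarget_eq (u : Rˣ) {b : ℕ} (hu : (u : R) = b)
    (w : Multiplicative (Fin N → ℤ) →* R) (hw : ∀ e : Fin N → ℤ, w (Multiplicative.ofAdd e) = ((u ^ (-satakeTwistExp e) : Rˣ) : R)) :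
    (twistedSatakeTarget R N b).map (monomialTwist w).toLinearMap = Subalgebra.toSubmodule (unitarySatakeTarget R N) := by
  obtain ⟨w', hw'⟩ := exists_monoidHom_apply_ofAdd_eq_units_zpow (Λ := Fin N → ℤ) u
    (AddMonoidHom.mk' (fun e : Fin N → ℤ => satakeTwistExp e) satakeTwistExp_add)
  have hww' : ∀ l, w l * w' l = 1 := fun l => by
    rw [← ofAdd_toAdd l, hw, hw', AddMonoidHom.mk'_apply, ← Units.val_mul, ← zpow_add, neg_add_cancel, zpow_zero, Units.val_one]
  refine le_antisymm ?_ fun g hg => ?_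
  · rintro _ ⟨f, hf, rfl⟩
    exact (monomialTwist_mem_unitarySatakeTarget_iff_mem_twistedSatakeTarget u hu w hw f).2 hf
  · refine ⟨monomialTwist w' g, ?_, monomialTwist_monomialTwist_of_mul_eq_one w w' hww' g⟩
    refine (monomialTwist_mem_unitarySatakeTarget_iff_mem_twistedSatakeTarget u hu w hw _).1 ?_
    rw [monomialTwist_monomialTwist_of_mul_eq_one w w' hww' g]
    exact hg

end Unitary

/-! ## §2 `O_N(J₀)`: `monomialTwist (u^{-Λ}) (𝒯^{O}_R(q)) = R[Λ⁻]^W` for `u² = q` -/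

section Orthogonal

/-- **`monomialTwist w f ∈ R[Λ⁻]^W ⟺ f ∈ R[Λ]^{(W,*)}(u²)`** for the orthogonal weight `w = u^{-Λ}`, `Λ = ⟨ν,·⟩ - hs`, ANY unit `u`:
honest `W`-invariance of `u^{-Λ(μ)} f_μ` is `f_{μ∘π} = u^{Λ(μ∘π)-Λ(μ)} f_μ = (u²)^{(Λ(μ∘π)-Λ(μ))/2} f_μ` (the exponent is even by
g49-#10). [cite: CartierCorvallis1979, §IV (4.2)–(4.3)] [cite: TreumannVenkatesh2016, §7.2] -/
theorem monomialTwist_mem_unitarySatakeTarget_iff_mem_orthogonalStarInvariants (u : Rˣ)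
    (w : Multiplicative (Fin N → ℤ) →* R)
    (hw : ∀ e : Fin N → ℤ, w (Multiplicative.ofAdd e) = ((u ^ (-(satakeTwistExp e - headSum e (N / 2))) : Rˣ) : R))
    (f : AddMonoidAlgebra R (Fin N → ℤ)) :
    monomialTwist w f ∈ unitarySatakeTarget R N ↔ f ∈ orthogonalStarInvariants R N (u ^ 2) := by
  rw [mem_unitarySatakeTarget_iff, mem_orthogonalStarInvariants_iff]
  simp only [coeff_monomialTwist, hw, ← orthogonalTwistExp_eq]
  constructor
  · rintro ⟨hs, h⟩
    refine ⟨fun μ hμ => (Units.isUnit _).mul_right_eq_zero.1 (hs μ hμ), fun π hπ μ hμ => ?_⟩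
    have h2 := two_dvd_orthogonalTwistExp_comp_sub hμ hπ
    rw [(units_zpow_neg_mul_eq_iff u _ _ _ _).1 (h π hπ μ), ← zpow_natCast, ← zpow_mul,
      show ((2 : ℕ) : ℤ) * ((orthogonalTwistExp (μ ∘ ⇑π) - orthogonalTwistExp μ) / 2) =
        orthogonalTwistExp (μ ∘ ⇑π) - orthogonalTwistExp μ by push_cast; omega]
  · rintro ⟨hs, h⟩
    refine ⟨fun μ hμ => by rw [hs μ hμ, mul_zero], fun π hπ μ => ?_⟩
    rw [units_zpow_neg_mul_eq_iff]
    by_cases hμ : ∀ i, μ (Fin.rev i) = -μ i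
    · have h2 := two_dvd_orthogonalTwistExp_comp_sub hμ hπ
      rw [h π hπ μ hμ, ← zpow_natCast, ← zpow_mul,
        show ((2 : ℕ) : ℤ) * ((orthogonalTwistExp (μ ∘ ⇑π) - orthogonalTwistExp μ) / 2) =
          orthogonalTwistExp (μ ∘ ⇑π) - orthogonalTwistExp μ by push_cast; omega]
    · have hμ' : ¬ ∀ i, (μ ∘ ⇑π) (Fin.rev i) = -(μ ∘ ⇑π) i := fun h' => hμ fun i => by
        have e : π (π⁻¹ i) = i := by rw [Equiv.Perm.coe_inv, Equiv.apply_symm_apply]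
        have := h' (π⁻¹ i)
        rwa [Function.comp_apply, Function.comp_apply, hπ, e] at this
      rw [hs μ hμ, hs _ hμ', mul_zero]

/-- **`monomialTwist w f ∈ R[Λ⁻]^W ⟺ f ∈ 𝒯^{O}_R(q)`** for `w = u^{-Λ}` with `u² = q` in `R` (g49-#11 identifies `R[Λ]^{(W,*)}(u²)` with
`𝒯^{O}_R(q)`). [cite: CartierCorvallis1979, §IV (4.2)–(4.3)] [cite: TreumannVenkatesh2016, §7.2 Thm. (i)] -/
theorem monomialTwist_mem_unitarySatakeTarget_iff_mem_orthogonalTwistedSatakeTarget (u : Rˣ) {q : ℕ} (hu : (u : R) ^ 2 = q)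
    (w : Multiplicative (Fin N → ℤ) →* R)
    (hw : ∀ e : Fin N → ℤ, w (Multiplicative.ofAdd e) = ((u ^ (-(satakeTwistExp e - headSum e (N / 2))) : Rˣ) : R))
    (f : AddMonoidAlgebra R (Fin N → ℤ)) :
    monomialTwist w f ∈ unitarySatakeTarget R N ↔ f ∈ orthogonalTwistedSatakeTarget R N q := by
  rw [monomialTwist_mem_unitarySatakeTarget_iff_mem_orthogonalStarInvariants u w hw,
    orthogonalStarInvariants_eq_orthogonalTwistedSatakeTarget (u ^ 2) q (by rw [Units.val_pow_eq_pow_val, hu])]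

/-- **`monomialTwist (u^{-Λ})` maps `𝒯^{O}_R(q)` ONTO `R[Λ⁻]^W`** (`u² = q`): the images of `ℋ(O_N(J₀), K₀; R)` under the counting
transform (g49-#9) and under the orthogonally normalised transform (g49-#3) correspond.
[cite: CartierCorvallis1979, §IV (4.2)–(4.3)] [cite: TreumannVenkatesh2016, §7.2] -/
theorem map_monomialTwist_orthogonalTwistedSatakeTarget_eq (u : Rˣ) {q : ℕ} (hu : (u : R) ^ 2 = q)
    (w : Multiplicative (Fin N → ℤ) →* R)
    (hw : ∀ e : Fin N → ℤ, w (Multiplicative.ofAdd e) = ((u ^ (-(satakeTwistExp e - headSum e (N / 2))) : Rˣ) : R)) :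
    (orthogonalTwistedSatakeTarget R N q).map (monomialTwist w).toLinearMap = Subalgebra.toSubmodule (unitarySatakeTarget R N) := by
  obtain ⟨w', hw'⟩ := exists_monoidHom_apply_ofAdd_eq_units_zpow (Λ := Fin N → ℤ) u
    (AddMonoidHom.mk' (fun e : Fin N → ℤ => satakeTwistExp e - headSum e (N / 2)) fun a c => by
      rw [satakeTwistExp_add, headSum_add]; ring)
  have hww' : ∀ l, w l * w' l = 1 := fun l => by
    rw [← ofAdd_toAdd l, hw, hw', AddMonoidHom.mk'_apply, ← Units.val_mul, ← zpow_add, neg_add_cancel, zpow_zero, Units.val_one]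
  refine le_antisymm ?_ fun g hg => ?_
  · rintro _ ⟨f, hf, rfl⟩
    exact (monomialTwist_mem_unitarySatakeTarget_iff_mem_orthogonalTwistedSatakeTarget u hu w hw f).2 hf
  · refine ⟨monomialTwist w' g, ?_, monomialTwist_monomialTwist_of_mul_eq_one w w' hww' g⟩
    refine (monomialTwist_mem_unitarySatakeTarget_iff_mem_orthogonalTwistedSatakeTarget u hu w hw _).1 ?_
    rw [monomialTwist_monomialTwist_of_mul_eq_one w w' hww' g]
    exact hg

end Orthogonal

/-! ## §3 The commutative squares with the transforms -/

variable {K : Type*} [Field K] [Valued K ℤᵐ⁰] {σ : K →+* K} {ϖ : K}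

namespace UnramifiedLocalConjDatum

/-- **`satakeAlgEquivOfUnits = monomialTwist w ∘ countingSatakeLinearEquiv`** on `ℋ(U(σ,J₀), K₀; R)` (`u = q_F ∈ Rˣ`, `w = u^{-⟨ν,·⟩}`):
the isomorphism of g49-#1 is the twist of the counting isomorphism of g49-#6. [cite: CartierCorvallis1979, §IV (4.2)]
[cite: TreumannVenkatesh2016, §7.2] -/
theorem coe_satakeAlgEquivOfUnits_eq_monomialTwist_countingSatakeLinearEquiv [Finite 𝓀[K]]
    [IsHeckeTriple (⊤ : Submonoid (unitaryGroupOfForm σ ((StdForm.antidiagonal N).over K)))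
      (unitaryInt σ ((StdForm.antidiagonal N).over K)) (unitaryInt σ ((StdForm.antidiagonal N).over K))]
    (hd : UnramifiedLocalConjDatum σ ϖ) (hσ : ∃ x : K, σ x ≠ x) (u : Rˣ) (hu : (u : R) = Nat.sqrt (Nat.card 𝓀[K]))
    (w : Multiplicative (Fin N → ℤ) →* R) (hw : ∀ e : Fin N → ℤ, w (Multiplicative.ofAdd e) = ((u ^ (-satakeTwistExp e) : Rˣ) : R))
    (T : heckeAlgebra R (unitaryGroupOfForm σ ((StdForm.antidiagonal N).over K)) (unitaryInt σ ((StdForm.antidiagonal N).over K))) :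
    ((hd.satakeAlgEquivOfUnits hσ u hu w hw T : unitarySatakeTarget R N) : AddMonoidAlgebra R (Fin N → ℤ)) =
      monomialTwist w ((hd.countingSatakeLinearEquiv hσ T : twistedSatakeTarget R N (Nat.sqrt (Nat.card 𝓀[K]))) :
        AddMonoidAlgebra R (Fin N → ℤ)) := by
  rw [hd.coe_satakeAlgEquivOfUnits hσ u hu w hw T, hd.countingSatakeLinearEquiv_apply hσ T,
    (hd.isIwasawaExponent (N := N)).satakeTransform_eq_monomialTwist_comp w, AlgHom.comp_apply]

/-- **`satakeAlgEquivOrthogonal = monomialTwist w ∘ countingSatakeLinearEquivOrthogonal`** on `ℋ(O_N(J₀), K₀; R)` (`u² = q`,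
`w = u^{-Λ}`): the isomorphism of g49-#3 is the twist of the counting isomorphism of g49-#9. [cite: CartierCorvallis1979, §IV (4.2)]
[cite: TreumannVenkatesh2016, §7.2] -/
theorem coe_satakeAlgEquivOrthogonal_eq_monomialTwist_countingSatakeLinearEquivOrthogonal [Finite 𝓀[K]]
    [IsHeckeTriple (⊤ : Submonoid (unitaryGroupOfForm (RingHom.id K) ((StdForm.antidiagonal N).over K)))
      (unitaryInt (RingHom.id K) ((StdForm.antidiagonal N).over K)) (unitaryInt (RingHom.id K) ((StdForm.antidiagonal N).over K))]
    (hd : UnramifiedLocalConjDatum (RingHom.id K) ϖ) (u : Rˣ) (hu : (u : R) ^ 2 = Nat.card 𝓀[K])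
    (w : Multiplicative (Fin N → ℤ) →* R)
    (hw : ∀ e : Fin N → ℤ, w (Multiplicative.ofAdd e) =
      ((u ^ (-∑ p ∈ (Finset.univ : Finset (Fin N × Fin N)) with (p.1 < p.2 ∧ p.1 < Fin.rev p.2), (e p.1 - e p.2)) : Rˣ) : R))
    (T : heckeAlgebra R (unitaryGroupOfForm (RingHom.id K) ((StdForm.antidiagonal N).over K))
      (unitaryInt (RingHom.id K) ((StdForm.antidiagonal N).over K))) :
    ((hd.satakeAlgEquivOrthogonal u hu w hw T : unitarySatakeTarget R N) : AddMonoidAlgebra R (Fin N → ℤ)) =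
      monomialTwist w ((hd.countingSatakeLinearEquivOrthogonal T : orthogonalTwistedSatakeTarget R N (Nat.card 𝓀[K])) :
        AddMonoidAlgebra R (Fin N → ℤ)) := by
  rw [hd.coe_satakeAlgEquivOrthogonal u hu w hw T, hd.countingSatakeLinearEquivOrthogonal_apply T,
    (hd.isIwasawaExponent (N := N)).satakeTransform_eq_monomialTwist_comp w, AlgHom.comp_apply]

end UnramifiedLocalConjDatum

end Literature.NumberTheory.Automorphic.HermitianLattice

end
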